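import Literature.AlgebraicGeometry.Resolution.TameTowerInertiaField
import Mathlib.FieldTheory.Minpoly.Field
import Mathlib.LinearAlgebra.Eigenspace.Minpoly
import Mathlib.RingTheory.RootsOfUnity.PrimitiveRoots
import Mathlib.GroupTheory.PGroup
import HarnessLib

/-!
# The inertia group is a `p`-group when there is no tame ramification (Kuhlmann 2010, §5)

Topic: `Literature/AlgebraicGeometry/Resolution` (valued function fields). PROVED input of the
reduction step of F.-V. Kuhlmann, *Elimination of ramification I*, Trans. AMS 362 (2010) =
arXiv:1003.5678, §5, proof of (R4), p. 19: "Since the ramification group is a `p`-group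
(cf. [En]), `F^sep|F^r` is a `p`-extension", combined with Lemma 2.27, Case II: "`vF = vK` is
divisible, and since `vE/vF` is finite, `vE = vF`" — i.e. over the fields of the application
there is no tame ramification at all, and the whole inertia group is a `p`-group. Setting of
`TameTowerInertiaField.lean`: `(Ω, V)`, `F ≤ Ω`, `L|F` finite inside `Ω`, the inertia condition
`v(σ x - x) > 0` on `L ∩ V`.

* `not_inertia_of_orderOf_eq_prime` — **an automorphism of prime order `ℓ ≠ p = char Ωv`
  satisfying the inertia condition does not exist** when `F` contains a primitive `ℓ`-th root
  of unity `ζ` and every value of `L` is a value of `F` (`vL = vF`; the stability of `V` is not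
  even needed): `σ` has minimal polynomial
  `X^ℓ - 1` as an `F`-linear map (`minpoly_algEquiv_toLinearMap`), hence an eigenvector
  `σ u = ζ u`, which may be normalised to `v(u) = 0` using `vL = vF`; then
  `v(σ u - u) = v(ζ - 1) > 0` forces `ζ̄ = 1`, and `0 = ∑_{i<ℓ} ζ̄^i = ℓ` in `Ωv`, i.e.
  `p ∣ ℓ`.
* `isPGroup_of_inertia` — hence a subgroup of `Gal(L|F)` all of whose elements satisfy the
  inertia condition is a `p`-group, provided `F` has primitive `ℓ`-th roots of unity for all
  primes `ℓ ≠ p` and `vL = vF`.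

## Sources

* F.-V. Kuhlmann, loc. cit., §5 p. 19 and Lemma 2.27; O. Endler, *Valuation theory* (1972),
  §20 (the ramification group is a pro-`p` group; `I/R ≅ Hom(vL/vF, (Lv)^×)`). [folklore]
-/

noncomputable section

open Module IntermediateField IsLocalRing Polynomial

namespace Literature.AlgebraicGeometry.Resolution

universe u

variable {Ω : Type u} [Field Ω] {V : ValuationSubring Ω}
variable {F : Subfield Ω} {L : IntermediateField F Ω}

/-- **No inertia in prime order `ℓ ≠ p`** (see the module docstring): for `L|F` finite inside
`(Ω, V)`, `char Ωv = p`, a primitive `ℓ`-th root of unity in `F` (`ℓ ≠ p` prime) and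
`vL = vF`, no `σ ∈ Gal(L|F)` of order `ℓ` satisfies `v(σ x - x) > 0` for all `x ∈ L ∩ V`.
[cite: Kuhlmann2010, Section 5, proof of (R4) (p. 19) and Lemma 2.27] -/
theorem not_inertia_of_orderOf_eq_prime {p : ℕ} [hp : Fact p.Prime] [CharP (ResidueField V) p]
    [FiniteDimensional F L] {ℓ : ℕ} (hℓ : ℓ.Prime) (hℓp : ℓ ≠ p) {ζ : F}
    (hζ : IsPrimitiveRoot ζ ℓ)
    (hval : ∀ x : L, x ≠ 0 → ∃ c : F, V.valuation (c : Ω) = V.valuation (x : Ω))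
    (σ : L ≃ₐ[F] L) (hσ : orderOf σ = ℓ)
    (hin : ∀ x : L, (x : Ω) ∈ V → V.valuation (((σ x : L) : Ω) - x) < 1) : False := by
  -- an eigenvector `σ w = ζ w`
  have hmin : minpoly F σ.toLinearMap = X ^ ℓ - C 1 := by
    rw [minpoly_algEquiv_toLinearMap σ (isOfFinOrder_of_finite σ), hσ]
  have hroot : (minpoly F σ.toLinearMap).IsRoot ζ := by
    rw [hmin, IsRoot.def, eval_sub, eval_pow, eval_X, eval_C, hζ.pow_eq_one, sub_self]
  obtain ⟨w, hw⟩ := (Module.End.hasEigenvalue_of_isRoot hroot).exists_hasEigenvector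
  have hσw : σ w = ζ • w := by rw [← AlgEquiv.toLinearMap_apply]; exact hw.apply_eq_smul
  have hw0 : w ≠ 0 := hw.2
  -- normalise to a unit `u` of `V`
  obtain ⟨c, hc⟩ := hval w hw0
  have hw0' : (w : Ω) ≠ 0 := fun h => hw0 (by exact_mod_cast h)
  have hc0' : (c : Ω) ≠ 0 := fun h => by
    rw [h, map_zero] at hc
    exact hw0' ((map_eq_zero V.valuation).mp hc.symm)
  have hc0 : c ≠ 0 := fun h => hc0' (by rw [h]; rfl)
  set u : L := (algebraMap F L c)⁻¹ * w with hu
  have hσu : σ u = ζ • u := by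
    rw [hu, map_mul, map_inv₀, AlgEquiv.commutes, hσw, Algebra.smul_def, Algebra.smul_def]
    ring
  have hucoe : (u : Ω) = (c : Ω)⁻¹ * w := by rw [hu]; push_cast; rfl
  have hvu : V.valuation (u : Ω) = 1 := by
    rw [hucoe, map_mul, map_inv₀, hc, inv_mul_cancel₀ ((map_ne_zero V.valuation).mpr hw0')]
  have huV : (u : Ω) ∈ V := (V.valuation_le_one_iff _).mp hvu.le
  -- `v(σ u - u) = v(ζ - 1) < 1`
  have h1 := hin u huV
  have hdiff : ((σ u : L) : Ω) - u = ((ζ : Ω) - 1) * u := by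
    rw [hσu, Algebra.smul_def]
    push_cast
    have : ((algebraMap F L ζ : L) : Ω) = (ζ : Ω) := rfl
    rw [this]
    ring
  rw [hdiff, map_mul, hvu, mul_one] at h1
  -- `ζ ∈ V` with residue `1`
  have hζℓ : (ζ : Ω) ^ ℓ = 1 := by
    have := congrArg (fun t : F => (t : Ω)) hζ.pow_eq_one
    push_cast at this
    exact this
  have hζV : (ζ : Ω) ∈ V := mem_of_pow_mem hℓ.ne_zero (by rw [hζℓ]; exact V.one_mem)
  have hres : residue V ⟨(ζ : Ω), hζV⟩ = 1 := by
    have h2 : residue V ⟨(ζ : Ω), hζV⟩ = residue V ⟨1, V.one_mem⟩ :=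
      (residue_mk_eq_iff V hζV V.one_mem).mpr h1
    rw [h2]
    exact map_one (residue V)
  -- `0 = ∑_{i<ℓ} ζ̄^i = ℓ` in `Ωv`, so `p ∣ ℓ`
  have hsum : ∑ i ∈ Finset.range ℓ, (ζ : Ω) ^ i = 0 :=
    (hζ.map_of_injective (f := algebraMap F Ω) (algebraMap F Ω).injective).geom_sum_eq_zero
      hℓ.one_lt
  have hsumV : (∑ i ∈ Finset.range ℓ, (⟨(ζ : Ω), hζV⟩ : V) ^ i) = 0 := by
    apply Subtype.ext
    push_cast
    exact hsum
  have hℓ0 : (ℓ : ResidueField V) = 0 := by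
    have := congrArg (residue V) hsumV
    rw [map_sum, map_zero] at this
    simp only [map_pow, hres, one_pow, Finset.sum_const, Finset.card_range, nsmul_eq_mul,
      mul_one] at this
    exact this
  rw [CharP.cast_eq_zero_iff (ResidueField V) p] at hℓ0
  exact hℓp ((Nat.prime_dvd_prime_iff_eq hp.out hℓ).mp hℓ0).symm

/-- **A subgroup of `Gal(L|F)` satisfying the inertia condition is a `p`-group** (`p` the residue
characteristic) when `F` contains primitive `ℓ`-th roots of unity for all primes `ℓ ≠ p` and
`vL = vF` (no tame ramification): every prime divisor `ℓ` of the order of `σ ∈ I` is `p`, since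
`σ^{ord σ/ℓ} ∈ I` has order `ℓ` (`not_inertia_of_orderOf_eq_prime`).
[cite: Kuhlmann2010, Section 5, proof of (R4) (p. 19) and Lemma 2.27] -/
theorem isPGroup_of_inertia {p : ℕ} [hp : Fact p.Prime] [CharP (ResidueField V) p]
    [FiniteDimensional F L]
    (hroots : ∀ ℓ : ℕ, ℓ.Prime → ℓ ≠ p → ∃ ζ : F, IsPrimitiveRoot ζ ℓ)
    (hval : ∀ x : L, x ≠ 0 → ∃ c : F, V.valuation (c : Ω) = V.valuation (x : Ω))
    (I : Subgroup (L ≃ₐ[F] L))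
    (hI : ∀ σ ∈ I, ∀ x : L, (x : Ω) ∈ V → V.valuation (((σ x : L) : Ω) - x) < 1) :
    IsPGroup p I := by
  intro g
  have hord : orderOf (g : L ≃ₐ[F] L) ≠ 0 := (orderOf_pos _).ne'
  -- every prime divisor of the order of `g` is `p`
  have key : ∀ {d : ℕ}, d.Prime → d ∣ orderOf (g : L ≃ₐ[F] L) → d = p := by
    intro d hd hdvd
    by_contra hne
    obtain ⟨ζ, hζ⟩ := hroots d hd hne
    have hτ : orderOf ((g : L ≃ₐ[F] L) ^ (orderOf (g : L ≃ₐ[F] L) / d)) = d :=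
      orderOf_pow_orderOf_div hord hdvd
    exact not_inertia_of_orderOf_eq_prime hd hne hζ hval _ hτ
      (hI _ (I.pow_mem g.2 _))
  refine ⟨(orderOf (g : L ≃ₐ[F] L)).primeFactorsList.length, ?_⟩
  have h1 := Nat.eq_prime_pow_of_unique_prime_dvd hord key
  apply Subtype.ext
  rw [Subgroup.coe_pow, Subgroup.coe_one, ← h1]
  exact pow_orderOf_eq_one _

end Literature.AlgebraicGeometry.Resolution
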